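import Literature.AlgebraicGeometry.Kawanoue2007.CoefficientLemma
import Literature.AlgebraicGeometry.Kawanoue2007.DSaturationLocalization
import Literature.AlgebraicGeometry.KawanoueMatsuki2010.MuTildeOnGenerators
import Literature.AlgebraicGeometry.Resolution.SmoothImpliesRegular
import HarnessLib

/-!
# Kawanoue–Matsuki 2010 (IFP Part II), Proposition 3.1.2.1: the invariant `μ_ℋ(𝕀_P)` is independent of
# the leading generator system — PROVED

H. Kawanoue, K. Matsuki, *Toward resolution of singularities over a field of positive characteristic (the
Idealistic Filtration Program). Part II. Basic invariants associated to the idealistic filtration and their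
properties*, Publ. RIMS **46** (2010) 359–422 (= arXiv:math/0612008) [KawanoueMatsuki2010], Chapter 3
«§3.1.2. Invariant `μ_ℋ` is independent of `ℋ`», **Proposition 3.1.2.1** (chunk p0043 L3–L5) with its proof
(p0043 L7 – p0045 L28), read on the held arXiv text (`lit read paper:arxiv-math-0612008`, chunks p0043–p0045;
locators = chunk:line). Campaign `res-hironaka` (D-0089), rung LIT-6, seat res-lit-2: discharge road of the
seat's named fact `KawanoueMatsuki2010_prop_3_1_2_1` (F-93, `InvariantsAtClosedPoint.lean`; the discharge
`KawanoueMatsuki2010_prop_3_1_2_1_holds` is appended THERE and is two lines from `muTilde_atPrime_eq_of_isLGS`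
below). NO named fact is introduced (net debt 0 here, −1 with the appended discharge). Nothing of H. Hironaka's
2017 manuscript is referred to or asserted.

## What is printed (locators)

* Prop. 3.1.2.1 (p0043 L3–L5): «Let the setting be as described in 3.1.1. Then `μ_ℋ(𝕀_P)` is independent of
  the choice of `ℋ`, i.e., independent of the choice of a leading generator system `ℍ` for `𝕀_P`.»
* Proof (p0043 L7 – p0045 L28). Reductions: the case `μ_P(𝕀) < 1` (then `𝕀_P = R_P × ℝ`, `μ_ℋ = 0`), Case 1
  (`μ_ℋ = 1` for all `ℋ`), Case 2 (`μ_ℋ(𝕀_P) > 1` for some `ℋ`): it suffices to show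
  «(∗) `μ_{ℋ'}(𝕀_P) ≥ μ_ℋ(𝕀_P)`» (p0043 L29); observation (1) (p0043 L39 – p0044 L6): replacing `ℋ'` by a
  linear transformation `ℋ''` one may assume «`ℋ` and `ℋ'` share the same leading terms, i.e.
  `h_l ≡ h'_l mod 𝔪_P^{p^{e_l}+1}`»; observation (2) (p0044 L8–L16): a chain `ℋ = ℋ_0, ℋ_1, …, ℋ_N = ℋ'`
  «where the adjacent sets share all but one elements in common»; the one-element step (p0044 L30 – p0045 L26):
  with `1 < ν < μ_ℋ(𝕀_P)`, `h − h' ∈ 𝔪_P^{⌈νp^{e_{l_o}}⌉} + (ℋ)` and `h − h' ∈ 𝔪_P^{p^{e_{l_o}}+1}`, hence by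
  «Lemma 4.1.2.3 in Part I» `h − h' = g_1 + h r + g_2` with `r ∈ 𝔪_P`, so `u = 1 − r` is a unit and
  `h ∈ 𝔪_P^{⌈νp^{e_{l_o}}⌉} + (ℋ')` (p0044 L63); then «by Coefficient Lemma in Part I, where
  `(𝕀_P)'_t = (𝕀_P)_t ∩ 𝔪_P^{⌈νt⌉}`» (p0045 L1) `f ∈ ∑_B (𝕀_P)'_{a−|[B]|} H^B ⊂ … + (ℋ')`, whence
  `ord_{ℋ'}(f) ≥ νa` (p0045 L12–L14), `μ_{ℋ'}(f, a) ≥ ν`, and `μ_{ℋ'}(𝕀_P) ≥ μ_ℋ(𝕀_P)` (p0045 L26).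

## What is proved here, and how (faithfulness notes)

* `muTilde_eq_of_isLGS` — **Prop. 3.1.2.1** for ANY 𝔇-saturated idealistic filtration `𝕀` over a regular local
  ring `R` essentially of finite type and formally smooth over a perfect field `k`, of exponential characteristic
  `p` (the printed `R_P`, `P` a closed point of a variety smooth over `k = k̄`, is an instance:
  `muTilde_atPrime_eq_of_isLGS`), and any two finite leading generator systems `(h, e)`, `(h', e')`
  (`IsLGS p 𝕀`): `muTilde 𝕀 h = muTilde 𝕀 h'` (`muTilde` = the tree's `μ_ℋ(𝕀)`, `WeakOrderMuTilde.lean`).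
* ROUTE = the printed one, with the three printed reductions arranged as lemmas:
  (1) `exists_mem_span_sub_mem` (observation (1)): from the basis property `IsLGS.span_eq` of `ℋ'`, a family
  `h''` with `h''_l ∈ (ℋ')`, `(h''_l, p^{e_l}) ∈ 𝕀` and `h''_l ≡ h_l mod 𝔪^{p^{e_l}+1}` — the printed `ℋ''` «obtained
  from `ℋ'` by a linear transformation»; we only use `(ℋ'') ⊂ (ℋ')`, which gives `μ_{ℋ''} ≤ μ_{ℋ'}`
  (`muMod_mono`), so the invertibility of the printed `g_e ∈ GL` is not needed;
  `isWeakLGS_congr` (the systems `ℋ_j` of the chain are again (weak) leading generator systems: conditions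
  (i), (ii) only see the classes `h̄_l`);
  (2) `muTilde_le_muTilde_of_sub_mem` (observation (2), induction over the finite set of replaced indices);
  the one-element step `muTilde_le_muTilde_of_update` = p0044 L30 – p0045 L26 VERBATIM (Part I Lemma 4.1.2.3 =
  `Kawanoue2007.exists_coeff_mem_pow_of_mem_span_inter_pow`, the Coefficient Lemma = `Kawanoue2007.coefficientLemma`,
  `SupportingLemmas.lean` / `CoefficientLemma.lean`), run for EVERY `0 ≤ ν < μ_ℋ(𝕀_P)`: for `ν ≤ 1` the membership
  `h ∈ 𝔪^{⌈νp^{e_{l_o}}⌉} + (ℋ')` of p0044 L63 is immediate from `h ∈ 𝔪^{p^{e_{l_o}}}`, so the printed preliminary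
  cases (`μ_P(𝕀) < 1`, Case 1) are not needed as separate arguments; the conclusion (∗) is obtained for all pairs.
  The Coefficient Lemma is used for the weak class of Rem. 3.1.3.3 (2) (`IsWeakLGS`), as proved in Part I.

AI-written; AI review is weaker than expert review.

## References

* H. Kawanoue, K. Matsuki, Publ. RIMS 46 (2010) 359–422 = arXiv:math/0612008: Prop. 3.1.2.1 (chunk p0043 L3–L5),
  proof (p0043 L7 – p0045 L28). [KawanoueMatsuki2010]
* H. Kawanoue, Publ. RIMS 43 (2007) 819–909 = arXiv:math/0607009: Lemma 4.1.2.3, Lemma 4.1.4.1 (through the tree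
  files `Kawanoue2007/SupportingLemmas.lean`, `Kawanoue2007/CoefficientLemma.lean`), Def. 3.1.3.1, Def. 3.2.2.1,
  Prop. 2.4.2.1 (2) (`DSaturationLocalization.lean`). [Kawanoue2007]
-/

noncomputable section

namespace Literature.AlgebraicGeometry.KawanoueMatsuki2010

open Literature.AlgebraicGeometry.Kawanoue2007
open Literature.RingTheory.HilbertSamuel (gradedPiece gradedPiece.mk)
open IsLocalRing
open scoped ENNReal

universe u

/-! ## Observation (1), first half: conditions (i), (ii) of a leading generator system only see the leading terms -/

section Congr

variable {R : Type*} [CommRing R] [IsLocalRing R] (p : ℕ) {ι : Type*}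

/-- `a ≡ b mod 𝔪ⁿ⁺¹` with `b ∈ 𝔪ⁿ` implies `aᵐ ≡ bᵐ mod 𝔪^{nm+1}`. [folklore] -/
private theorem pow_sub_pow_mem_pow_mul_succ {a b : R} {n : ℕ} (hb : b ∈ maximalIdeal R ^ n)
    (hab : a - b ∈ maximalIdeal R ^ (n + 1)) (m : ℕ) :
    a ^ m - b ^ m ∈ maximalIdeal R ^ (n * m + 1) := by
  have ha : a ∈ maximalIdeal R ^ n := by
    simpa using add_mem (Ideal.pow_le_pow_right (Nat.le_succ n) hab) hb
  induction m with
  | zero => simp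
  | succ m ih =>
    have e : a ^ (m + 1) - b ^ (m + 1) = a * (a ^ m - b ^ m) + (a - b) * b ^ m := by ring
    rw [e]
    refine add_mem ?_ ?_
    · have := Ideal.mul_mem_mul ha ih
      rw [← pow_add] at this
      convert this using 2
      ring
    · have := Ideal.mul_mem_mul hab (Ideal.pow_mem_pow hb m)
      rw [← pow_mul, ← pow_add] at this
      convert this using 2
      ring

/-- Two families with the same leading terms `h''_l ≡ h_l mod 𝔪^{p^{e_l}+1}` have the same families
`{h̄_l^{p^{e−e_l}} ; e_l ≤ e} ⊂ G_{p^e}` of Def. 3.1.3.1 (ii) («share the same leading terms», p0044 L3–L5).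
[cite: KawanoueMatsuki2010, Prop. 3.1.2.1 (proof, observation (1), chunk p0044 L3–L5)] -/
theorem lgsFamily_congr {h h'' : ι → R} {e : ι → ℕ} (hh : ∀ i, h i ∈ maximalIdeal R ^ p ^ e i)
    (hh'' : ∀ i, h'' i ∈ maximalIdeal R ^ p ^ e i)
    (hsub : ∀ i, h'' i - h i ∈ maximalIdeal R ^ (p ^ e i + 1)) (e₀ : ℕ) :
    lgsFamily p h'' e hh'' e₀ = lgsFamily p h e hh e₀ := by
  funext i
  unfold lgsFamily
  rw [← sub_eq_zero, ← map_sub, gradedPiece.mk_eq_zero_iff]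
  have := pow_sub_pow_mem_pow_mul_succ (hh i) (hsub i) (p ^ (e₀ - e i))
  rw [← pow_add, Nat.add_sub_cancel' i.2] at this
  simpa using this

/-- **A weak leading generator system stays one under a change of representatives of its leading terms inside
`𝕀`**: if `(h, e)` satisfies (i) and the weak (ii) of Rem. 3.1.3.3 (2), `(h''_l, p^{e_l}) ∈ 𝕀` and
`h''_l ≡ h_l mod 𝔪^{p^{e_l}+1}`, then so does `(h'', e)` (the systems `ℋ''`, `ℋ_j` of the printed proof,
p0043 L43 and p0044 L8–L10, «leading generator systems for `𝕀_P`»).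
[cite: KawanoueMatsuki2010, Prop. 3.1.2.1 (proof, observations (1)–(2), chunk p0043 L43 – p0044 L10)] -/
theorem isWeakLGS_congr {𝕀 : IdealisticFiltration R} {h h'' : ι → R} {e : ι → ℕ} (H : IsWeakLGS p 𝕀 h e)
    (hlev : ∀ i, h'' i ∈ 𝕀.level ((p ^ e i : ℕ) : ℝ))
    (hsub : ∀ i, h'' i - h i ∈ maximalIdeal R ^ (p ^ e i + 1)) : IsWeakLGS p 𝕀 h'' e := by
  have hh'' : ∀ i, h'' i ∈ maximalIdeal R ^ p ^ e i := fun i => by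
    simpa using add_mem (Ideal.pow_le_pow_right (Nat.le_succ _) (hsub i)) (H.pow_mem i)
  have hmk : ∀ i, gradedPiece.mk (maximalIdeal R) (p ^ e i) ⟨h'' i, hh'' i⟩ =
      gradedPiece.mk (maximalIdeal R) (p ^ e i) ⟨h i, H.pow_mem i⟩ := fun i => by
    rw [← sub_eq_zero, ← map_sub, gradedPiece.mk_eq_zero_iff]
    simpa using hsub i
  refine ⟨hlev, hh'', fun i => ?_, fun e₀ => ?_⟩
  · rw [hmk]; exact H.pure i
  · rw [lgsFamily_congr p H.pow_mem hh'' hsub e₀]; exact H.linearIndependent e₀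

/-- The same transfer for leading generator systems proper (Def. 3.1.3.1: also «distinct elements» and «forms a basis»):
both conditions only see the family `{h̄_l^{p^{e−e_l}}}`, which is unchanged. (Used when an LGS is replaced by one with the
same leading terms, e.g. the `ℋ''` of observation (1), or the `p^{e}`-th powers of Thm. A.1.1.1.)
[cite: KawanoueMatsuki2010, Prop. 3.1.2.1 (proof, observations (1)–(2), chunk p0043 L43 – p0044 L10)] -/
theorem isLGS_congr {𝕀 : IdealisticFiltration R} {h h'' : ι → R} {e : ι → ℕ} (H : IsLGS p 𝕀 h e)
    (hlev : ∀ i, h'' i ∈ 𝕀.level ((p ^ e i : ℕ) : ℝ))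
    (hsub : ∀ i, h'' i - h i ∈ maximalIdeal R ^ (p ^ e i + 1)) : IsLGS p 𝕀 h'' e := by
  have hh'' : ∀ i, h'' i ∈ maximalIdeal R ^ p ^ e i := fun i => by
    simpa using add_mem (Ideal.pow_le_pow_right (Nat.le_succ _) (hsub i)) (H.pow_mem i)
  have hmk : ∀ i, gradedPiece.mk (maximalIdeal R) (p ^ e i) ⟨h'' i, hh'' i⟩ =
      gradedPiece.mk (maximalIdeal R) (p ^ e i) ⟨h i, H.pow_mem i⟩ := fun i => by
    rw [← sub_eq_zero, ← map_sub, gradedPiece.mk_eq_zero_iff]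
    simpa using hsub i
  refine ⟨hlev, hh'', fun i => ?_, fun e₀ => ?_, fun e₀ => ?_, fun e₀ => ?_⟩
  · rw [hmk]; exact H.pure i
  · rw [lgsFamily_congr p H.pow_mem hh'' hsub e₀]; exact H.injective e₀
  · rw [lgsFamily_congr p H.pow_mem hh'' hsub e₀]; exact H.linearIndependent e₀
  · rw [lgsFamily_congr p H.pow_mem hh'' hsub e₀]; exact H.span_eq e₀

end Congr

/-! ## Observation (1), second half: lifting the leading terms of `ℋ` into `(ℋ')` -/

section Transfer

variable {R : Type*} [CommRing R] [IsLocalRing R] (p : ℕ) [ExpChar R p] {ι ι' : Type*}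

/-- **Observation (1)** [p0043 L39 – p0044 L6: «There is also `ℋ''`, obtained from `ℋ'` by a linear transformation,
such that `ℋ''` and `ℋ` share the same leading terms»]: for a weak leading generator system `(h, e)` and a leading
generator system `(h', e')` of the same `𝕀`, there is a family `h''` indexed like `h` with `h''_l ∈ (ℋ')`,
`(h''_l, p^{e_l}) ∈ 𝕀` and `h''_l ≡ h_l mod 𝔪^{p^{e_l}+1}` — each leading term `h̄_l ∈ L(𝕀)^{pure}_{p^{e_l}}` is a
combination of the basis `{h̄'_m{}^{p^{e_l−e'_m}}}` (Def. 3.1.3.1 (ii) for `ℋ'`), and the coefficients are lifted to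
`R`. [cite: KawanoueMatsuki2010, Prop. 3.1.2.1 (proof, observation (1), chunk p0043 L39 – p0044 L6)] -/
theorem exists_mem_span_sub_mem [Fintype ι'] {𝕀 : IdealisticFiltration R} {h : ι → R} {e : ι → ℕ}
    {h' : ι' → R} {e' : ι' → ℕ} (H : IsWeakLGS p 𝕀 h e) (H' : IsLGS p 𝕀 h' e') :
    ∃ h'' : ι → R, (∀ l, h'' l ∈ Ideal.span (Set.range h')) ∧
      (∀ l, h'' l ∈ 𝕀.level ((p ^ e l : ℕ) : ℝ)) ∧ (∀ l, h'' l - h l ∈ maximalIdeal R ^ (p ^ e l + 1)) := by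
  classical
  have hp : 0 < p := expChar_pos R p
  have key : ∀ l, ∃ y : R, y ∈ Ideal.span (Set.range h') ∧ y ∈ 𝕀.level ((p ^ e l : ℕ) : ℝ) ∧
      y - h l ∈ maximalIdeal R ^ (p ^ e l + 1) := by
    intro l
    have hw : gradedPiece.mk (maximalIdeal R) (p ^ e l) ⟨h l, H.pow_mem l⟩ ∈
        (Submodule.span (ResidueField R) (Set.range (lgsFamily p h' e' H'.pow_mem (e l))) :
          Set (gradedPiece (maximalIdeal R) (p ^ e l))) := by
      rw [H'.span_eq]; exact H.pure l
    obtain ⟨c, hc⟩ := (Submodule.mem_span_range_iff_exists_fun (ResidueField R)).mp hw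
    choose c' hc' using fun m => IsLocalRing.residue_surjective (c m)
    have hpm : ∀ m : {m : ι' // e' m ≤ e l}, h' m ^ p ^ (e l - e' m) ∈ maximalIdeal R ^ p ^ e l :=
      fun m => pow_mem_pow_of_le p m.2 (H'.pow_mem m)
    have hy : (∑ m, c' m * h' m ^ p ^ (e l - e' m)) ∈ maximalIdeal R ^ p ^ e l :=
      Ideal.sum_mem _ fun m _ => Ideal.mul_mem_left _ _ (hpm m)
    refine ⟨∑ m, c' m * h' m ^ p ^ (e l - e' m), ?_, ?_, ?_⟩
    · refine Ideal.sum_mem _ fun m _ => Ideal.mul_mem_left _ _ ?_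
      have hm : h' m ∈ Ideal.span (Set.range h') := Ideal.subset_span ⟨(m : ι'), rfl⟩
      exact Ideal.pow_mem_of_mem _ hm _ (pow_pos hp _)
    · refine Ideal.sum_mem _ fun m _ => Ideal.mul_mem_left _ _ ?_
      have h1 := 𝕀.pow_mem (H'.level_mem m) (p ^ (e l - e' m))
      have e1 : ((p ^ (e l - e' m) : ℕ) : ℝ) * ((p ^ e' (m : ι') : ℕ) : ℝ) = ((p ^ e l : ℕ) : ℝ) := by
        rw [← Nat.cast_mul, ← pow_add, Nat.sub_add_cancel m.2]
      rw [← e1]; exact h1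
    · have hmk : gradedPiece.mk (maximalIdeal R) (p ^ e l) ⟨_, hy⟩ =
          gradedPiece.mk (maximalIdeal R) (p ^ e l) ⟨h l, H.pow_mem l⟩ := by
        rw [← hc]
        have hx : (⟨∑ m, c' m * h' m ^ p ^ (e l - e' m), hy⟩ : ↥(maximalIdeal R ^ p ^ e l)) =
            ∑ m, c' m • (⟨h' m ^ p ^ (e l - e' m), hpm m⟩ : ↥(maximalIdeal R ^ p ^ e l)) := by
          apply Subtype.ext
          simp [smul_eq_mul]
        rw [hx, map_sum]
        refine Finset.sum_congr rfl fun m _ => ?_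
        rw [map_smul, ← hc' m]
        exact (algebraMap_smul (ResidueField R) (c' m) _).symm
      rw [← sub_eq_zero, ← map_sub, gradedPiece.mk_eq_zero_iff] at hmk
      simpa using hmk
  choose y hy₁ hy₂ hy₃ using key
  exact ⟨y, hy₁, hy₂, hy₃⟩

end Transfer

/-! ## The one-element step (p0044 L30 – p0045 L26) and the chain (observation (2)) -/

section OneStep

/-- `ν ≤ μ_I(f, a)` from `f ∈ 𝔪^{⌈νa⌉} + I` (`⌈νa⌉ ≤ ord_I(f)`; the step «`ord_{ℋ'}(f) ≥ νa`. This implies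
`μ_{ℋ'}(f, a) ≥ ν`», p0045 L12–L18). [cite: KawanoueMatsuki2010, Prop. 3.1.2.1 (proof, chunk p0045 L12–L18)] -/
theorem ofReal_le_muModElem_of_mem {S : Type*} [CommRing S] [IsLocalRing S] (I : Ideal S) {ν a : ℝ}
    (hν : 0 ≤ ν) (ha : 0 < a) {f : S} (hf : f ∈ maximalIdeal S ^ ⌈ν * a⌉₊ ⊔ I) :
    ENNReal.ofReal ν ≤ muModElem I f a := by
  have h1 : ((⌈ν * a⌉₊ : ℕ) : ℕ∞) ≤ ordMod I f := (le_ordMod_iff I f _).mpr hf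
  unfold muModElem
  rw [ENNReal.le_div_iff_mul_le (Or.inl (ENNReal.ofReal_pos.mpr ha).ne') (Or.inl ENNReal.ofReal_ne_top),
    ← ENNReal.ofReal_mul hν]
  calc ENNReal.ofReal (ν * a) ≤ ENNReal.ofReal ((⌈ν * a⌉₊ : ℕ) : ℝ) := ENNReal.ofReal_le_ofReal (Nat.le_ceil _)
    _ = (((⌈ν * a⌉₊ : ℕ) : ℕ∞) : ℝ≥0∞) := by rw [ENNReal.ofReal_natCast, ENat.toENNReal_coe]
    _ ≤ ((ordMod I f : ℕ∞) : ℝ≥0∞) := ENat.toENNReal_le.mpr h1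

/-- `(𝔪ⁿ + J)^b ⊂ 𝔪^{bn} + J`. [cite: KawanoueMatsuki2010, Rem. 3.1.1.2 (1)] -/
theorem pow_sup_pow_le {S : Type*} [CommRing S] [IsLocalRing S] (J : Ideal S) (n b : ℕ) :
    (maximalIdeal S ^ n ⊔ J) ^ b ≤ maximalIdeal S ^ (b * n) ⊔ J := by
  induction b with
  | zero => simp
  | succ b ih =>
    rw [pow_succ, Nat.succ_mul]
    exact (Ideal.mul_mono ih le_rfl).trans (pow_sup_mul_pow_sup_le J _ _)

/-- Products: `x_l ∈ 𝔪^{n_l} + J` for `l ∈ s` ⟹ `∏_{l ∈ s} x_l^{b_l} ∈ 𝔪^{∑_{l∈s} b_l n_l} + J` (the estimate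
`∑_B (𝕀_P)'_{a−|[B]|} H^B ⊂ ∑_b (𝕀_P)'_{a−bp^{e_{l_o}}} 𝔪_P^{b⌈νp^{e_{l_o}}⌉} + (ℋ')`, p0045 L3–L8).
[cite: KawanoueMatsuki2010, Prop. 3.1.2.1 (proof, chunk p0045 L3–L8)] -/
theorem prod_pow_mem_pow_sup {S : Type*} [CommRing S] [IsLocalRing S] (J : Ideal S) {α : Type*}
    (s : Finset α) {x : α → S} {n : α → ℕ} (b : α → ℕ) (hx : ∀ l ∈ s, x l ∈ maximalIdeal S ^ n l ⊔ J) :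
    ∏ l ∈ s, x l ^ b l ∈ maximalIdeal S ^ (∑ l ∈ s, b l * n l) ⊔ J := by
  classical
  induction s using Finset.induction_on with
  | empty => simp
  | @insert a s ha ih =>
    rw [Finset.prod_insert ha, Finset.sum_insert ha]
    have h1 : x a ^ b a ∈ maximalIdeal S ^ (b a * n a) ⊔ J :=
      pow_sup_pow_le J (n a) (b a) (Ideal.pow_mem_pow (hx a (Finset.mem_insert_self a s)) (b a))
    exact pow_sup_mul_pow_sup_le J _ _
      (Ideal.mul_mem_mul h1 (ih fun l hl => hx l (Finset.mem_insert_of_mem hl)))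

variable {k : Type*} [Field k] [PerfectField k] {R : Type u} [CommRing R] [IsRegularLocalRing R] [Algebra k R]
  [Algebra.EssFiniteType k R] [Algebra.FormallySmooth k R]
variable (p : ℕ) [ExpChar R p] {ι : Type*} [Fintype ι] (𝕀 : IdealisticFiltration R)

/-- **The one-element step** [p0044 L18 – p0045 L26]: `𝕀` 𝔇-saturated, `𝒦 = (κ, e)` a weak leading generator system,
`𝒦'` the same family except at ONE index `l_o`, where `(κ'_{l_o}, p^{e_{l_o}}) ∈ 𝕀` and
`κ'_{l_o} ≡ κ_{l_o} mod 𝔪^{p^{e_{l_o}}+1}` («(1) share the same leading terms … (2) share all but one element in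
common»). Then «(∗) `μ_{ℋ'}(𝕀_P) ≥ μ_ℋ(𝕀_P)`»: for every `0 ≤ ν < μ_𝒦(𝕀)` one has
`h = κ_{l_o} ∈ 𝔪^{⌈νp^{e_{l_o}}⌉} + (𝒦')` — for `ν > 1` by the printed argument (`h − h' ∈ 𝔪^{⌈νp^{e_{l_o}}⌉} + (ℋ)`
by definition of `μ_ℋ`, `h − h' ∈ 𝔪^{p^{e_{l_o}}+1}`, Part I Lemma 4.1.2.3, `u = 1 − r` a unit, p0044 L34–L63), for
`ν ≤ 1` because `h ∈ 𝔪^{p^{e_{l_o}}}` —, then by the Coefficient Lemma of Part I with `(𝕀)'_t = 𝕀_t ∩ 𝔪^{⌈νt⌉}`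
every `(f, a) ∈ 𝕀`, `a > 0`, lies in `𝔪^{⌈νa⌉} + (𝒦')` (p0044 L65 – p0045 L14), so `μ_{𝒦'}(f, a) ≥ ν`.
[cite: KawanoueMatsuki2010, Prop. 3.1.2.1 (proof, chunk p0044 L18 – p0045 L26)] -/
theorem muTilde_le_muTilde_of_update (hD : 𝕀.IsDSaturated k) {κ κ' : ι → R} {e : ι → ℕ}
    (H : IsWeakLGS p 𝕀 κ e) (l₀ : ι) (hne : ∀ l, l ≠ l₀ → κ' l = κ l)
    (hlev : κ' l₀ ∈ 𝕀.level ((p ^ e l₀ : ℕ) : ℝ))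
    (hsub : κ' l₀ - κ l₀ ∈ maximalIdeal R ^ (p ^ e l₀ + 1)) :
    muTilde 𝕀 κ ≤ muTilde 𝕀 κ' := by
  classical
  have hp : 0 < p := expChar_pos R p
  set J : Ideal R := Ideal.span (Set.range κ') with hJ
  have hκ'J : ∀ l, κ' l ∈ J := fun l => Ideal.subset_span ⟨l, rfl⟩
  have hκJ : ∀ l, l ≠ l₀ → κ l ∈ J := fun l hl => hne l hl ▸ hκ'J l
  -- `h ∈ 𝔪^{⌈ν p^{e_{l_o}}⌉} + (ℋ')` (p0044 L63), for every admissible `ν`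
  have step1 : ∀ ν : ℝ, 0 ≤ ν → ENNReal.ofReal ν < muTilde 𝕀 κ →
      κ l₀ ∈ maximalIdeal R ^ ⌈ν * ((p ^ e l₀ : ℕ) : ℝ)⌉₊ ⊔ J := by
    intro ν hν0 hν
    rcases le_or_gt ν 1 with hν1 | hν1
    · refine Ideal.mem_sup_left (Ideal.pow_le_pow_right ?_ (H.pow_mem l₀))
      exact Nat.ceil_le.mpr (mul_le_of_le_one_left (Nat.cast_nonneg _) hν1)
    · set g : R := κ l₀ - κ' l₀ with hg
      have hgI : g ∈ 𝕀.level ((p ^ e l₀ : ℕ) : ℝ) := Ideal.sub_mem _ (H.level_mem l₀) hlev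
      have hE0 : (0 : ℝ) < ((p ^ e l₀ : ℕ) : ℝ) := by exact_mod_cast pow_pos hp (e l₀)
      -- definition of `μ_ℋ(𝕀)`: `h − h' ∈ 𝔪^{⌈νp^e⌉} + (ℋ)` (p0044 L38)
      obtain ⟨f₁, hf₁, f₂, hf₂, hfg⟩ :=
        Submodule.mem_sup.mp (mem_pow_ceil_sup_span_of_lt_muTilde 𝕀 κ hν0 hν hgI hE0)
      -- `⌈νp^e⌉ ≥ p^e + 1` (p0044 L44) and `f₂ ∈ (ℋ) ∩ 𝔪^{p^e+1}` (p0044 L46)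
      have hceil : p ^ e l₀ + 1 ≤ ⌈ν * ((p ^ e l₀ : ℕ) : ℝ)⌉₊ :=
        Nat.succ_le_of_lt (Nat.lt_ceil.mpr (lt_mul_left hE0 hν1))
      have hgm : g ∈ maximalIdeal R ^ (p ^ e l₀ + 1) := by
        rw [hg, ← neg_sub]; exact Submodule.neg_mem _ hsub
      have hf₂m : f₂ ∈ maximalIdeal R ^ (p ^ e l₀ + 1) := by
        have : f₂ = g - f₁ := by rw [← hfg]; ring
        rw [this]
        exact Ideal.sub_mem _ hgm (Ideal.pow_le_pow_right hceil hf₁)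
      -- Part I Lemma 4.1.2.3: retake the coefficients (p0044 L50–L55)
      obtain ⟨γ, hγ, hsum⟩ := exists_coeff_mem_pow_of_mem_span_inter_pow p κ e H.pow_mem
        (fun l => (H.pure l).2) H.linearIndependent hf₂m hf₂
      have hγ0 : γ l₀ ∈ maximalIdeal R := by
        have := hγ l₀
        rwa [Nat.add_sub_cancel_left, pow_one] at this
      have hS : ∑ l, γ l * κ l = ∑ l, γ l * κ' l + γ l₀ * g := by
        have h1 : ∑ l, γ l * κ l - ∑ l, γ l * κ' l = γ l₀ * g := by
          rw [← Finset.sum_sub_distrib, Finset.sum_eq_single l₀]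
          · rw [hg]; ring
          · intro l _ hl; rw [hne l hl, sub_self]
          · intro h0; exact absurd (Finset.mem_univ l₀) h0
        linear_combination h1
      have hS' : ∑ l, γ l * κ' l ∈ J := Ideal.sum_mem _ fun l _ => Ideal.mul_mem_left _ _ (hκ'J l)
      -- `(1 − r) h = g_1 + h' + g_2`, `u = 1 − r` a unit (p0044 L59–L63)
      have hu : IsUnit (1 - γ l₀) :=
        IsLocalRing.isUnit_one_sub_self_of_mem_nonunits _ ((IsLocalRing.mem_maximalIdeal _).mp hγ0)
      have hkey : (1 - γ l₀) * g ∈ maximalIdeal R ^ ⌈ν * ((p ^ e l₀ : ℕ) : ℝ)⌉₊ ⊔ J := by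
        have e1 : g = f₁ + f₂ := hfg.symm
        rw [hsum, hS] at e1
        have e2 : (1 - γ l₀) * g = f₁ + ∑ l, γ l * κ' l := by linear_combination e1
        rw [e2]
        exact add_mem (Ideal.mem_sup_left hf₁) (Ideal.mem_sup_right hS')
      have hgU : g ∈ maximalIdeal R ^ ⌈ν * ((p ^ e l₀ : ℕ) : ℝ)⌉₊ ⊔ J :=
        (Ideal.unit_mul_mem_iff_mem _ hu).mp hkey
      have e3 : κ l₀ = g + κ' l₀ := by rw [hg]; ring
      rw [e3]
      exact add_mem hgU (Ideal.mem_sup_right (hκ'J l₀))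
  -- `μ_{ℋ'}(f, a) ≥ ν` for every `(f, a) ∈ 𝕀`, `a > 0` (p0044 L65 – p0045 L18), by the Coefficient Lemma
  have hdeg : ∀ (ν a : ℝ) (B : ι →₀ ℕ), 0 ≤ ν →
      ⌈ν * a⌉₊ ≤ ⌈ν * (a - bracketDeg p e B)⌉₊ + ∑ l, B l * ⌈ν * ((p ^ e l : ℕ) : ℝ)⌉₊ := by
    intro ν a B hν0
    refine Nat.ceil_le.mpr ?_
    have h1 : ν * (a - bracketDeg p e B) ≤ (⌈ν * (a - bracketDeg p e B)⌉₊ : ℝ) := Nat.le_ceil _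
    have h2 : ∀ l, (B l : ℝ) * (ν * ((p ^ e l : ℕ) : ℝ)) ≤ (B l : ℝ) * (⌈ν * ((p ^ e l : ℕ) : ℝ)⌉₊ : ℝ) :=
      fun l => mul_le_mul_of_nonneg_left (Nat.le_ceil _) (Nat.cast_nonneg _)
    have h3 : (bracketDeg p e B : ℝ) = ∑ l, (B l : ℝ) * ((p ^ e l : ℕ) : ℝ) := by
      simp [bracketDeg, Nat.cast_sum, Nat.cast_mul]
    have h4 := Finset.sum_le_sum fun l (_ : l ∈ Finset.univ) => h2 l
    have hD' : ν * (bracketDeg p e B : ℝ) = ∑ l, (B l : ℝ) * (ν * ((p ^ e l : ℕ) : ℝ)) := by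
      rw [h3, Finset.mul_sum]; exact Finset.sum_congr rfl fun l _ => by ring
    calc ν * a = ν * (a - bracketDeg p e B) + ν * (bracketDeg p e B : ℝ) := by ring
      _ ≤ (⌈ν * (a - bracketDeg p e B)⌉₊ : ℝ) + ∑ l, (B l : ℝ) * (⌈ν * ((p ^ e l : ℕ) : ℝ)⌉₊ : ℝ) := by
          rw [hD']; exact add_le_add h1 h4
      _ = ((⌈ν * (a - bracketDeg p e B)⌉₊ + ∑ l, B l * ⌈ν * ((p ^ e l : ℕ) : ℝ)⌉₊ : ℕ) : ℝ) := by
          push_cast; rfl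
  have step2 : ∀ ν : ℝ, 0 ≤ ν → ENNReal.ofReal ν < muTilde 𝕀 κ → ENNReal.ofReal ν ≤ muTilde 𝕀 κ' := by
    intro ν hν0 hν
    refine (le_muTilde_iff 𝕀 κ').mpr fun f a hfa ha => ofReal_le_muModElem_of_mem J hν0 ha ?_
    have hV : ∀ l, κ l ∈ maximalIdeal R ^ ⌈ν * ((p ^ e l : ℕ) : ℝ)⌉₊ ⊔ J := by
      intro l
      by_cases hl : l = l₀
      · subst hl; exact step1 ν hν0 hν
      · exact Ideal.mem_sup_right (hκJ l hl)
    rw [coefficientLemma (k := k) p κ e 𝕀 hD H hν0 hν a] at hfa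
    refine (show qIdeal p κ e 𝕀 ν a ≤ maximalIdeal R ^ ⌈ν * a⌉₊ ⊔ J from iSup_le fun B => ?_) hfa
    have hH : hPow κ B ∈ maximalIdeal R ^ (∑ l, B l * ⌈ν * ((p ^ e l : ℕ) : ℝ)⌉₊) ⊔ J :=
      prod_pow_mem_pow_sup J Finset.univ B fun l _ => hV l
    calc levelCut 𝕀 ν (a - bracketDeg p e B) * Ideal.span {hPow κ B}
        ≤ maximalIdeal R ^ ⌈ν * (a - bracketDeg p e B)⌉₊ *
            (maximalIdeal R ^ (∑ l, B l * ⌈ν * ((p ^ e l : ℕ) : ℝ)⌉₊) ⊔ J) :=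
          Ideal.mul_mono (levelCut_le_pow 𝕀 ν _) ((Ideal.span_singleton_le_iff_mem _).mpr hH)
      _ ≤ maximalIdeal R ^ (⌈ν * (a - bracketDeg p e B)⌉₊ + ∑ l, B l * ⌈ν * ((p ^ e l : ℕ) : ℝ)⌉₊) ⊔ J :=
          (Ideal.mul_mono le_sup_left le_rfl).trans (pow_sup_mul_pow_sup_le J _ _)
      _ ≤ maximalIdeal R ^ ⌈ν * a⌉₊ ⊔ J := sup_le_sup_right (Ideal.pow_le_pow_right (hdeg ν a B hν0)) _
  -- `ν` arbitrary below `μ_ℋ(𝕀)` (p0045 L20–L26)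
  by_contra hlt
  obtain ⟨r, hr0, h1, h2⟩ := ENNReal.lt_iff_exists_real_btwn.mp (not_le.mp hlt)
  exact absurd (step2 r hr0 h2) (not_le.mpr h1)

/-- **Observation (2), the chain `ℋ = ℋ_0, ℋ_1, …, ℋ_N = ℋ''`** [p0044 L8–L16]: for a weak leading generator system
`(h, e)` of the 𝔇-saturated `𝕀` and a family `h''` with `(h''_l, p^{e_l}) ∈ 𝕀`, `h''_l ≡ h_l mod 𝔪^{p^{e_l}+1}`,
`μ_ℋ(𝕀) ≤ μ_{ℋ''}(𝕀)` — replace the elements one at a time (`muTilde_le_muTilde_of_update`; the intermediate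
families are weak leading generator systems by `isWeakLGS_congr`).
[cite: KawanoueMatsuki2010, Prop. 3.1.2.1 (proof, observation (2), chunk p0044 L8–L16)] -/
theorem muTilde_le_muTilde_of_sub_mem (hD : 𝕀.IsDSaturated k) {h h'' : ι → R} {e : ι → ℕ}
    (H : IsWeakLGS p 𝕀 h e) (hlev : ∀ l, h'' l ∈ 𝕀.level ((p ^ e l : ℕ) : ℝ))
    (hsub : ∀ l, h'' l - h l ∈ maximalIdeal R ^ (p ^ e l + 1)) :
    muTilde 𝕀 h ≤ muTilde 𝕀 h'' := by
  classical
  have hF : ∀ S : Finset ι, IsWeakLGS p 𝕀 (fun l => if l ∈ S then h'' l else h l) e := fun S =>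
    isWeakLGS_congr p H (fun l => by split_ifs; exacts [hlev l, H.level_mem l])
      (fun l => by split_ifs; exacts [hsub l, by simp])
  have key : ∀ S : Finset ι, muTilde 𝕀 h ≤ muTilde 𝕀 (fun l => if l ∈ S then h'' l else h l) := by
    intro S
    induction S using Finset.induction_on with
    | empty => simp
    | @insert l₀ S hl₀ ih =>
      refine ih.trans (muTilde_le_muTilde_of_update (k := k) p 𝕀 hD (hF S) l₀ ?_ ?_ ?_)
      · intro l hl; simp [Finset.mem_insert, hl]
      · rw [if_pos (Finset.mem_insert_self l₀ S)]; exact hlev l₀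
      · rw [if_pos (Finset.mem_insert_self l₀ S), if_neg hl₀]; exact hsub l₀
  have hU : (fun l => if l ∈ (Finset.univ : Finset ι) then h'' l else h l) = h'' := funext fun l => by simp
  simpa [hU] using key Finset.univ

/-- «(∗) `μ_{ℋ'}(𝕀_P) ≥ μ_ℋ(𝕀_P)`» for ANY two leading generator systems [p0043 L29–L33 with observations (1), (2)]:
`μ_ℋ ≤ μ_{ℋ''} ≤ μ_{ℋ'}` for the lifted family `ℋ'' ⊂ (ℋ')` of `exists_mem_span_sub_mem`.
[cite: KawanoueMatsuki2010, Prop. 3.1.2.1 (proof, (∗), chunk p0043 L29–L33)] -/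
theorem muTilde_le_muTilde_of_isLGS (hD : 𝕀.IsDSaturated k) {ι' : Type*} [Fintype ι'] {h : ι → R}
    {e : ι → ℕ} {h' : ι' → R} {e' : ι' → ℕ} (H : IsLGS p 𝕀 h e) (H' : IsLGS p 𝕀 h' e') :
    muTilde 𝕀 h ≤ muTilde 𝕀 h' := by
  obtain ⟨h'', hspan, hlev, hsub⟩ := exists_mem_span_sub_mem p H.isWeakLGS H'
  calc muTilde 𝕀 h ≤ muTilde 𝕀 h'' := muTilde_le_muTilde_of_sub_mem (k := k) p 𝕀 hD H.isWeakLGS hlev hsub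
    _ ≤ muTilde 𝕀 h' := muMod_mono (Ideal.span_le.mpr (Set.range_subset_iff.mpr hspan)) _

/-- **Kawanoue–Matsuki 2010, Proposition 3.1.2.1** — PROVED [chunk p0043 L3–L5: «`μ_ℋ(𝕀_P)` is independent of the
choice of `ℋ`, i.e., independent of the choice of a leading generator system `ℍ` for `𝕀_P`»; p0043 L33: «by switching
the roles of `ℋ` and `ℋ'` … `μ_ℋ(𝕀_P) = μ_{ℋ'}(𝕀_P)`»]: for a 𝔇-saturated idealistic filtration `𝕀` over a regular
local ring `R` essentially of finite type and formally smooth over a perfect field `k`, of exponential characteristic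
`p`, and two finite leading generator systems `(h, e)`, `(h', e')` of `𝕀`: `μ_ℋ(𝕀) = μ_{ℋ'}(𝕀)`. The printed `R_P`
(localization at a closed point of a variety smooth over an algebraically closed field) is an instance
(`muTilde_atPrime_eq_of_isLGS`). -- TODO(general form): `R` = completion `R̂_P` is not covered.
[cite: KawanoueMatsuki2010, Prop. 3.1.2.1] -/
theorem muTilde_eq_of_isLGS (hD : 𝕀.IsDSaturated k) {ι' : Type*} [Fintype ι'] {h : ι → R} {e : ι → ℕ}
    {h' : ι' → R} {e' : ι' → ℕ} (H : IsLGS p 𝕀 h e) (H' : IsLGS p 𝕀 h' e') :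
    muTilde 𝕀 h = muTilde 𝕀 h' :=
  le_antisymm (muTilde_le_muTilde_of_isLGS (k := k) p 𝕀 hD H H')
    (muTilde_le_muTilde_of_isLGS (k := k) p 𝕀 hD H' H)

end OneStep

/-! ## Setting 3.1.1: the localization `R_P` at a closed point of a smooth variety over `k = k̄` -/

section AtPrime

/-- **Prop. 3.1.2.1 in Setting 3.1.1** [p0041 L19–L27, p0043 L3–L5]: `k` algebraically closed with `ExpChar k p`,
`A` a smooth finitely generated `k`-domain (the coordinate ring of an affine open of the nonsingular `W`), `𝕀` a
𝔇-saturated idealistic filtration over `A`, `𝔫 ⊂ A` maximal (a closed point `P`), and two finite leading generator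
systems of `𝕀_P = 𝕀.atPrime 𝔫`: `μ_ℋ(𝕀_P) = μ_{ℋ'}(𝕀_P)`. (`𝕀_P` is 𝔇-saturated by Part I Prop. 2.4.2.1 (2),
`IsDSaturated.atPrime`; `R_P` is a regular local ring, `Resolution.isRegularLocalRing_of_isSmoothAt`, essentially of
finite type and formally smooth over `k`.) [cite: KawanoueMatsuki2010, Prop. 3.1.2.1 with §3.1.1] -/
theorem muTilde_atPrime_eq_of_isLGS (p : ℕ) (k : Type u) [Field k] [IsAlgClosed k] [ExpChar k p]
    (A : Type u) [CommRing A] [IsDomain A] [Algebra k A] [Algebra.FiniteType k A] [Algebra.Smooth k A]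
    (𝕀 : IdealisticFiltration A) (hD : IdealisticFiltration.IsDSaturated k 𝕀)
    (𝔫 : Ideal A) [𝔫.IsMaximal] {ι ι' : Type*} [Finite ι] [Finite ι']
    {h : ι → Localization.AtPrime 𝔫} {e : ι → ℕ} {h' : ι' → Localization.AtPrime 𝔫} {e' : ι' → ℕ}
    (H : IsLGS p (𝕀.atPrime 𝔫) h e) (H' : IsLGS p (𝕀.atPrime 𝔫) h' e') :
    muTilde (𝕀.atPrime 𝔫) h = muTilde (𝕀.atPrime 𝔫) h' := by
  haveI : IsRegularLocalRing (Localization.AtPrime 𝔫) :=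
    Literature.AlgebraicGeometry.Resolution.isRegularLocalRing_of_isSmoothAt k A 𝔫
  haveI : ExpChar (Localization.AtPrime 𝔫) p :=
    expChar_of_injective_algebraMap (algebraMap k (Localization.AtPrime 𝔫)).injective p
  haveI : Algebra.EssFiniteType A (Localization.AtPrime 𝔫) :=
    Algebra.EssFiniteType.of_isLocalization (Localization.AtPrime 𝔫) 𝔫.primeCompl
  haveI : Algebra.EssFiniteType k (Localization.AtPrime 𝔫) :=
    Algebra.EssFiniteType.comp k A (Localization.AtPrime 𝔫)
  haveI : Algebra.FormallySmooth A (Localization.AtPrime 𝔫) :=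
    Algebra.FormallySmooth.of_isLocalization 𝔫.primeCompl
  haveI : Algebra.FormallySmooth k (Localization.AtPrime 𝔫) :=
    Algebra.FormallySmooth.comp k A (Localization.AtPrime 𝔫)
  haveI : Fintype ι := Fintype.ofFinite ι
  haveI : Fintype ι' := Fintype.ofFinite ι'
  exact muTilde_eq_of_isLGS (k := k) p (𝕀.atPrime 𝔫) (hD.atPrime k 𝔫) H H'

end AtPrime

end Literature.AlgebraicGeometry.KawanoueMatsuki2010

end
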